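import Literature.MathematicalPhysics.QuantumFieldTheory.Balaban1983to89.B9RowSum261Faces
import Literature.MathematicalPhysics.QuantumFieldTheory.Balaban1983to89.B9Thm39WholeGeneric
import Literature.MathematicalPhysics.QuantumFieldTheory.Balaban1983to89.B9Ineq347Reading
import Literature.MathematicalPhysics.QuantumFieldTheory.Balaban1983to89.B9GeoLemma21KLevelV1

/-!
# `Balaban1983to89.B9RowSum261DefiniteFaces` — [4] Lemma 2.1 SUPPLIED TO THE N06 KNIT WITH DEFINITE DATA: the (2.61) row-sum
# constant BY CHOICE (`rowConst261`), Lemma 2.1 «RM sufficiently large» with the exponent INSIDE the existential, and rows 15–16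
# (Theorem 3.9 ∧ the kernel summation) at the definite constant — a LITERAL pin with NO (2.61) hypothesis

T. Bałaban, *Propagators for lattice gauge theories in a background field*, Commun. Math. Phys. **99** (1985) 389–434
[`Balaban1985BackgroundPropagators`, "B9"], Thm 3.9 (3.98)–(3.99) p. 413, p. 398 «(3.47) are consequences of (3.42) and Lemma 2.1»;
[4] = T. Bałaban, *Propagators and renormalization transformations for lattice gauge theories. II*, Commun. Math. Phys. **96** (1984)
223–250 [`Balaban1984PropagatorsII`], Lemma 2.1 (2.59)–(2.61) pp. 233–234.

statement-level skeleton of published theorems with citation tags; proofs where landed; nothing here is a claim about the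
Yang–Mills mass gap

THE PRINTED LOCUS.  [4] p. 234: *"sup_{y∈𝔅} Σ_{y′∈𝔅} e^{−αδ₀d(y,y′)} ≤ c₁(α), (2.61)"* for *"RM satisfying (2.59)"*; [B9] p. 413:
*"For M sufficiently large, and a configuration U satisfying (3.35), the operator Q′G′²Q′\* has an inverse which can be represented as
(Q′G′²Q′\*)⁻¹ = Σ_ω R′₀(X₀)R′_{α₁}(X₁)·⋯·R′_{αₙ}(Xₙ) (3.98) … (3.99). This theorem implies Theorem 3.2."*

WHY THIS FILE (sequel of the sibling `B9RowSum261Faces` and of `B9Thm39WholeGeneric`).  The geometry of record supplies (2.61) only as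
the SCHEMA `B9Ineq349Whole.RowSum261 geo` = ∀κ > 0 ∃M_L ∃c (n06-i `B9GeoLemma21KLevelV1.rowSum261_geo9Y`): the constant is
EXISTENTIAL and rate-dependent.  Two consumers of the N06 knit cannot eat an existential:
* rows 15–16 pin the expansion datum LITERALLY, `(ops x).EK39 = EK39OfOps … (2(N·B₀)·c′) ((1−α′)r)` — a literal pin cannot name
  `∃ c′`, so the knit kept the PRINTED `B6.c1 (θ.d₆+1) r α′` (refuted as typed at D = 4, `B6Lemma21Counterexample`; referee REMARK R4);
* `B9Ineq347Reading.atOneGlobOn_of_atOneEOn` takes `hL21 : ∀ δ₀ > 0, ∃ M_L, Lemma21Above d …` with the (2.61) exponent `d` bound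
  OUTSIDE the ∀δ₀ — through the free-exponent door (`B9RowSum261Faces.exists_ineq261_of_rowSum261`) the schema yields only
  ∀δ₀ ∃d ∃M_L, the exponent INSIDE.
THIS FILE supplies both with DEFINITE data and nothing else:
* §1 `rowConst261 geo κ` — a (2.61) row-sum constant of the family at rate κ above SOME M-threshold, BY CHOICE (`Classical.choose` under
  `dite`, floored at 0): `rowConst261_nonneg` (unconditional), `rowConst261_spec`, `rowConst261_spec_of_rowSum261`,
  `ineq261With_rowConst261_of_rowSum261`, `ineq261With_pair_rowConst261_of_rowSum261`.
* §2 Lemma 2.1 «RM sufficiently large» WITH THE EXPONENT INSIDE: `ineq260_toB6_of_levelGap` ((2.60) for the transported geometry from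
  the geometric level gap, every rate), ★ `exists_lemma21Above_of_rowSum261` (`LevelGap` + `RowSum261` + `1 ≤ L_i ≤ L` ⇒ ∀ 0 < α < 1,
  δ₀ > 0: ∃ d M_L, `Lemma21Above d geo (fun _ => R₀) H δ₀ α M_L`), ★ `atOneGlobOn_of_atOneEOn_of_rowSum261` (the (3.42) ⇒ (3.47)
  passage at U = 1 of `B9Ineq347Reading` RE-DERIVED with `d` chosen after δ₀ — its `globBlockOn_of_eBlockOn_le` consumed verbatim —
  so `hL21` is REPLACED by the two record schemas); at def-Y's members `lemma21Above_geo9Y`, `atOneGlobOn_of_atOneEOn_geo9Y` (NO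
  Lemma-2.1 ∕ η ∕ L binder: n06-i's `levelGap_geo9Y_one`, `rowSum261_geo9Y`, `distOK_geo9Y` BY NAME).
* §3 ROWS 15–16 AT THE DEFINITE CONSTANT: ★ `thm39Printed_rowConst261_of_rowSum261`, ★★ `thm39_and_kernelSum_rowConst261_of_rowSum261`
  (`B9.Thm39Printed d c35 geo bg (fun i => EK39OfOps (𝔬 i) (rd i) d (2(N·B₀)·rowConst261 geo (α′r)) ((1−α′)r)) ∧ B9.RWKernelSumYields …
  Cinv` from `RowSum261 geo` — NO ∃, NO (2.61) hypothesis, no transport binders `R H`; every other input VERBATIM as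
  `B9Thm39WholeGeneric.thm39_and_kernelSum_of_rowSum261`), `thm39_and_kernelSum_of_pin_rowConst261` (pin form), `thm32Printed_of_pin_rowConst261`.
* §4 at def-Y's operator-layer signature `ops : ∀ x, OperatorLayerY … x` (the knit's currency, pattern of n06-d's `…Pins2.t39_of_pin` ∕
  `hksum_of_pin`): ★★ `t39_hksum_of_pin_rowConst261` — rows 15 ∧ 16 about `(ops x).EK39`, `(ops x).Cinv` from the LITERAL pin at
  `rowConst261 geo9Y (α′r)`, with ZERO Lemma-2.1 binders; `thm39_and_kernelSum_geo9Y` (the record corollary, explicit datum).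

HONEST SCOPE.  One definition by choice + kernel bookkeeping; nothing of [B9] or [4] asserted; the Theorem-3.9 schemas (`StaticOK39`,
`Locality39`, `Local348`, `Identities395`, `Small285`, `Factors389`, `KerReads`) stay DISPLAYED exactly as in the siblings; NOT a node
discharge; count-neutral; one finite 𝕋⁴ programme at fixed ε — nothing continuum, nothing about the mass gap.  Cell `pub-ymgap` (HUMAN
RULING D-0062), Track A node N06 [B9], seat `pub-ymgap-dag-n06-j` (harness re-seat gen 3), 2026-08-26.
-/

noncomputable section

namespace Literature.MathematicalPhysics.QuantumFieldTheory.Balaban1983to89.B9RowSum261DefiniteFaces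

open Literature.MathematicalPhysics.QuantumFieldTheory.Balaban1983to89
open Finset B6RandomWalk B9Thm34Ext B9Thm39Whole B9Thm39WholeGeneric B9RowSum261Faces
open B6Lemma21Repaired B9Ineq349Whole B9Ineq347Reading B9ResidualEntriesAtOne B9FromB6ModelSignsOn
open B9PinMembersKLevelV1 B9PinCarriersKLevelV1 B9GeoLemma21KLevelV1 B9GeoNormsKLevelModelSignsV1

/-! ## §1 The (2.61) row-sum constant of a family at rate κ, BY CHOICE -/

section RowConst

variable {I : Type} (geo : I → B9.Geometry) [∀ i, Fintype (geo i).Site]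

open Classical in
/-- **A (2.61) ROW-SUM CONSTANT OF THE FAMILY AT RATE κ, BY CHOICE** — p. 234 *"sup_{y∈𝔅} Σ_{y′∈𝔅} e^{−αδ₀d(y,y′)} ≤ c₁(α), (2.61)"*
for *"RM satisfying (2.59)"*: IF some real c bounds every row sum Σ_{y′∈𝔅} e^{−κd(y,y′)} of every member above SOME M-threshold, then
`rowConst261 geo κ` is such a c (chosen, floored at 0); otherwise it is 0.  OURS (a definite name for the generic constant of the schema
`B9Ineq349Whole.RowSum261`, so that a consumer can PIN data to it literally); c₁(α) of print is NOT asserted to be one.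
[cite: Balaban1984PropagatorsII, Lemma 2.1 (2.61) p.234 + (2.59) p.233] -/
def rowConst261 (κ : ℝ) : ℝ :=
  if h : ∃ c ML : ℝ, ∀ i : I, ML ≤ (geo i).M →
      ∀ y : (geo i).Site, ∑ y' : (geo i).Site, Real.exp (-(κ * (geo i).dist y y')) ≤ c
  then max (Classical.choose h) 0 else 0

/-- `0 ≤ rowConst261 geo κ`, unconditionally. [cite: Balaban1984PropagatorsII, Lemma 2.1 (2.61) p.234 (bookkeeping)] -/
theorem rowConst261_nonneg (κ : ℝ) : 0 ≤ rowConst261 geo κ := by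
  unfold rowConst261
  split_ifs
  · exact le_max_right _ _
  · exact le_rfl

variable {geo}

/-- **The defining property**: if some c bounds the row sums at rate κ above some M-threshold, then so does `rowConst261 geo κ` (above
some M-threshold). [cite: Balaban1984PropagatorsII, Lemma 2.1 (2.61) p.234 + (2.59) p.233] -/
theorem rowConst261_spec {κ : ℝ}
    (h : ∃ c ML : ℝ, ∀ i : I, ML ≤ (geo i).M →
      ∀ y : (geo i).Site, ∑ y' : (geo i).Site, Real.exp (-(κ * (geo i).dist y y')) ≤ c) :
    ∃ ML : ℝ, ∀ i : I, ML ≤ (geo i).M →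
      ∀ y : (geo i).Site, ∑ y' : (geo i).Site, Real.exp (-(κ * (geo i).dist y y')) ≤ rowConst261 geo κ := by
  have hdef : rowConst261 geo κ = max (Classical.choose h) 0 := by
    unfold rowConst261
    rw [dif_pos h]
  obtain ⟨ML, hML⟩ := Classical.choose_spec h
  exact ⟨ML, fun i hi y => (hML i hi y).trans (hdef ▸ le_max_left _ _)⟩

/-- **From the schema `RowSum261 geo`** (*"(2.61) … for RM satisfying (2.59)"* at every rate with a generic constant): at every rate
κ > 0 the row sums of every member above some M-threshold are `≤ rowConst261 geo κ`. [cite: Balaban1984PropagatorsII, Lemma 2.1 (2.61) p.234 + (2.59) p.233] -/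
theorem rowConst261_spec_of_rowSum261 (hrow : RowSum261 geo) {κ : ℝ} (hκ : 0 < κ) :
    ∃ ML : ℝ, ∀ i : I, ML ≤ (geo i).M →
      ∀ y : (geo i).Site, ∑ y' : (geo i).Site, Real.exp (-(κ * (geo i).dist y y')) ≤ rowConst261 geo κ := by
  obtain ⟨ML, c, h⟩ := hrow κ hκ
  exact rowConst261_spec ⟨c, ML, h⟩

/-- (2.61) WITH THE DEFINITE CONSTANT for the transported geometries `toB6 (geo i) (R i) (H i)` at the rate pair (δ₀, α), αδ₀ > 0,
above one M-threshold (`B6Lemma21Repaired.Ineq261With`). [cite: Balaban1984PropagatorsII, Lemma 2.1 (2.61) p.234 + (2.59) p.233] -/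
theorem ineq261With_rowConst261_of_rowSum261 (R : I → ℝ) (H : I → Prop) {δ₀ α : ℝ} (hκ : 0 < α * δ₀)
    (hrow : RowSum261 geo) :
    ∃ ML : ℝ, ∀ i, ML ≤ (geo i).M → Ineq261With (rowConst261 geo (α * δ₀)) (toB6 (geo i) (R i) (H i)) δ₀ α := by
  obtain ⟨ML, h⟩ := rowConst261_spec_of_rowSum261 hrow hκ
  exact ⟨ML, fun i hi y => h i hi y⟩

/-- The two (2.61) inputs of Theorem 3.9 — rates αδ₀ and α′r — WITH THE DEFINITE CONSTANTS `rowConst261 geo (αδ₀)`,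
`rowConst261 geo (α′r)`, above one M-threshold. [cite: Balaban1984PropagatorsII, Lemma 2.1 (2.61) p.234 + (2.59) p.233] -/
theorem ineq261With_pair_rowConst261_of_rowSum261 (R : I → ℝ) (H : I → Prop) {α α' r δ₀ : ℝ} (hκ₁ : 0 < α * δ₀)
    (hκ₂ : 0 < α' * r) (hrow : RowSum261 geo) :
    ∃ ML : ℝ, ∀ i, ML ≤ (geo i).M →
      Ineq261With (rowConst261 geo (α * δ₀)) (toB6 (geo i) (R i) (H i)) δ₀ α ∧
        Ineq261With (rowConst261 geo (α' * r)) (toB6 (geo i) (R i) (H i)) r α' := by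
  obtain ⟨ML₁, h₁⟩ := ineq261With_rowConst261_of_rowSum261 R H hκ₁ hrow
  obtain ⟨ML₂, h₂⟩ := ineq261With_rowConst261_of_rowSum261 R H hκ₂ hrow
  exact ⟨max ML₁ ML₂, fun i hi =>
    ⟨h₁ i ((le_max_left _ _).trans hi), h₂ i ((le_max_right _ _).trans hi)⟩⟩

end RowConst

/-! ## §2 [4] Lemma 2.1 «RM sufficiently large» from the record schemas, the (2.61) exponent INSIDE the existential -/

section Lemma21

variable {I : Type} {geo : I → B9.Geometry} [∀ i, Fintype (geo i).Site]

/-- **(2.60) for the transported geometry from the geometric level gap, at every rate αδ₀ ≥ 0**: `LevelGap geo R₀` (d(y, y′) ≧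
R₀·M·max(|j − j′| − 1, 0)) gives `Ineq260 (toB6 (geo i) R₀ H) δ₀ α` — p. 234 *"e^{−αδ₀d(y,y′)} ≤ e^{−αδ₀RM max{|j−j′|−1,0}} (2.60)"*
with R read as R₀. [cite: Balaban1984PropagatorsII, Lemma 2.1 (2.60) p.234] -/
theorem ineq260_toB6_of_levelGap {R₀ : ℝ} (hgap : LevelGap geo R₀) {δ₀ α : ℝ} (h : 0 ≤ α * δ₀) (H : Prop) (i : I) :
    Ineq260 (toB6 (geo i) R₀ H) δ₀ α := by
  intro y y'
  show Real.exp (-(α * δ₀ * (geo i).dist y y')) ≤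
    Real.exp (-(α * δ₀ * R₀ * (geo i).M * max (|((geo i).scale y : ℝ) - ((geo i).scale y' : ℝ)| - 1) 0))
  rw [Real.exp_le_exp, neg_le_neg_iff]
  have h1 := hgap i y y'
  calc α * δ₀ * R₀ * (geo i).M * max (|((geo i).scale y : ℝ) - ((geo i).scale y' : ℝ)| - 1) 0
      = α * δ₀ * (R₀ * (geo i).M * max (|((geo i).scale y : ℝ) - ((geo i).scale y' : ℝ)| - 1) 0) := by ring
    _ ≤ α * δ₀ * (geo i).dist y y' := mul_le_mul_of_nonneg_left h1 h

/-- ★ **[4] LEMMA 2.1 IN ITS PRINTED «RM SUFFICIENTLY LARGE» FORM FROM THE RECORD SCHEMAS, THE (2.61) EXPONENT INSIDE THE EXISTENTIAL.**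
From the level gap with parameter R₀ > 0, the row-sum schema `RowSum261 geo`, and 1 ≦ L_i ≦ L: for every 0 < α < 1 and δ₀ > 0 there
are an exponent d and a threshold M_L with `Lemma21Above d geo (fun _ => R₀) H δ₀ α M_L` — (2.60) at α (`ineq260_toB6_of_levelGap`),
(2.61) at 1 − α at the exponent d delivered by the free-exponent door (`B9RowSum261Faces.exists_ineq261_of_rowSum261`: c ≦ 12·c₀(½(1−α))^d
for some d since c₀ > 1), and the size condition 4·log L_i ≦ αδ₀R₀M above 4·log L∕(αδ₀R₀).  The exponent depends on the rate: the
schema's constant is arbitrary per rate, so NO single d serves every δ₀ by name — this is the form a consumer of `RowSum261` can discharge.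
[cite: Balaban1984PropagatorsII, Lemma 2.1 (2.59)–(2.61) pp.233–234] -/
theorem exists_lemma21Above_of_rowSum261 {R₀ : ℝ} (hR₀ : 0 < R₀) (hgap : LevelGap geo R₀) (hrow : RowSum261 geo)
    {L : ℝ} (hL1 : ∀ i, 1 ≤ (geo i).L) (hLle : ∀ i, (geo i).L ≤ L) (H : I → Prop)
    {α : ℝ} (hα0 : 0 < α) (hα1 : α < 1) {δ₀ : ℝ} (hδ₀ : 0 < δ₀) :
    ∃ (d : ℕ) (ML : ℝ), Lemma21Above d geo (fun _ => R₀) H δ₀ α ML := by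
  have hκ : 0 < (1 - α) * δ₀ := mul_pos (by linarith) hδ₀
  obtain ⟨ML₁, d, h261⟩ := exists_ineq261_of_rowSum261 (geo := geo) (fun _ => R₀) H hκ hrow
  have hc : 0 < α * δ₀ * R₀ := mul_pos (mul_pos hα0 hδ₀) hR₀
  refine ⟨d, max ML₁ (4 * Real.log L / (α * δ₀ * R₀)), fun i hi => ⟨?_, h261 i ((le_max_left _ _).trans hi), ?_⟩⟩
  · exact ineq260_toB6_of_levelGap hgap (mul_pos hα0 hδ₀).le (H i) i
  · have hM : 4 * Real.log L / (α * δ₀ * R₀) ≤ (geo i).M := (le_max_right _ _).trans hi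
    have hlog : Real.log (geo i).L ≤ Real.log L := Real.log_le_log (lt_of_lt_of_le one_pos (hL1 i)) (hLle i)
    have h2 : 4 * Real.log L ≤ (geo i).M * (α * δ₀ * R₀) := (div_le_iff₀ hc).mp hM
    show 4 * Real.log (geo i).L ≤ α * δ₀ * R₀ * (geo i).M
    nlinarith

/-- ★ **THE (3.47) LEAF AT U = 1 FROM THE (3.42) LEAF AT U = 1, WITH [4] LEMMA 2.1 SUPPLIED BY THE RECORD SCHEMAS** — the family lemma
`B9Ineq347Reading.atOneGlobOn_of_atOneEOn` RE-DERIVED with the (2.61) exponent chosen AFTER the leaf's δ₀ (its `hL21 : ∀ δ₀ > 0, ∃ M_L,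
Lemma21Above d …` binds `d` outside the ∀δ₀ and is not dischargeable by name from `RowSum261`): inputs = the sign facts, the glob-readings,
1 ≦ L_i ≦ L, η_i > 0, the level gap at R₀ > 0, `RowSum261 geo`, and the (3.42) leaf `AtOneEOn geo bg K P`; output `AtOneGlobOn geo bg K P`
(threshold max(M₁, M_L), constant B₀c₁(½)L⁴ + 1 at the door's exponent).  n06-h's one-member step `globBlockOn_of_eBlockOn_le` is used
verbatim with α = ½. [cite: Balaban1985BackgroundPropagators, Cor. 3.5 p.407 + (3.42) p.397 + (3.47) p.398; Balaban1984PropagatorsII, Lemma 2.1 (2.59)–(2.61) pp.233–234] -/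
theorem atOneGlobOn_of_atOneEOn_of_rowSum261 {bg : I → B9.Backgrounds} {K : ∀ i, B9.KernelFamily (geo i) (bg i)}
    {P Q : ∀ i, (geo i).Loc → Prop} (S : ∀ i, ModelSignsOn (geo i) (Q i))
    {res : ∀ i, (geo i).Site → (geo i).Loc → (geo i).Loc} (hR : ∀ i, GlobReading (K i) (P i) (bg i).one (res i))
    {L : ℝ} (hL : 1 ≤ L) (hL1 : ∀ i, 1 ≤ (geo i).L) (hLle : ∀ i, (geo i).L ≤ L) (hη : ∀ i, 0 < (geo i).eta)
    {R₀ : ℝ} (hR₀ : 0 < R₀) (hgap : LevelGap geo R₀) (hrow : RowSum261 geo) (hE : AtOneEOn geo bg K P) :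
    AtOneGlobOn geo bg K P := by
  obtain ⟨M₁, B₀, δ₀, hM₁, hB₀, hδ₀, HE⟩ := hE
  obtain ⟨d, ML, HL⟩ :=
    exists_lemma21Above_of_rowSum261 hR₀ hgap hrow hL1 hLle (fun _ => True) one_half_pos (by norm_num) hδ₀
  have hc1 : 0 ≤ B6.c1 d δ₀ (1 - 1 / 2) := c1_nonneg d δ₀ (1 - 1 / 2)
  have hL4 : ∀ i, (geo i).L ^ (4 : ℝ) ≤ L ^ (4 : ℝ) := fun i =>
    Real.rpow_le_rpow (le_trans zero_le_one (hL1 i)) (hLle i) (by norm_num)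
  refine ⟨max M₁ ML, B₀ * B6.c1 d δ₀ (1 - 1 / 2) * L ^ (4 : ℝ) + 1, lt_max_of_lt_left hM₁,
    lt_of_le_of_lt (mul_nonneg (mul_nonneg hB₀.le hc1) (Real.rpow_nonneg (le_trans zero_le_one hL) _)) (lt_add_one _),
    fun i hi => ?_⟩
  obtain ⟨h260, h261, hsize⟩ := HL i (le_trans (le_max_right _ _) hi)
  refine globBlockOn_of_eBlockOn_le (hR i) d hB₀.le (hL1 i) (hη i) (S i).wNorm_nonneg hsize h260 h261
    (HE i (le_trans (le_max_left _ _) hi)) ?_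
  exact (mul_le_mul_of_nonneg_left (hL4 i) (mul_nonneg hB₀.le hc1)).trans (le_add_of_nonneg_right zero_le_one)

end Lemma21

/-! ## §2b At def-Y's members `geo9Y x`: Lemma 2.1 and the (3.42) ⇒ (3.47) passage with NO Lemma-2.1 binder -/

section Lemma21StageY

variable {d ℓ : ℕ} {hd : 1 ≤ d + 1} {hL : Odd (ℓ + 1) ∧ 1 < ℓ + 1} {b₀ b₁ : ℝ} {Mstar : ℕ}
variable [∀ x : MemberY d ℓ hd hL b₀ b₁ Mstar, Fintype (geo9Y x).Site]

/-- ★ **[4] LEMMA 2.1 «RM SUFFICIENTLY LARGE» AT THE GEOMETRY OF RECORD, BY NAME** (R read as 1): for every 0 < α < 1, δ₀ > 0 there are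
d, M_L with `Lemma21Above d geo9Y (fun _ => 1) H δ₀ α M_L` — from n06-i's `levelGap_geo9Y_one`, `rowSum261_geo9Y`, `distOK_geo9Y`
(L_i = ℓ + 1 ≥ 1). [cite: Balaban1984PropagatorsII, Lemma 2.1 (2.59)–(2.61) pp.233–234] -/
theorem lemma21Above_geo9Y (H : MemberY d ℓ hd hL b₀ b₁ Mstar → Prop) {α : ℝ} (hα0 : 0 < α) (hα1 : α < 1)
    {δ₀ : ℝ} (hδ₀ : 0 < δ₀) :
    ∃ (dd : ℕ) (ML : ℝ),
      Lemma21Above dd (geo9Y (d := d) (ℓ := ℓ) (hd := hd) (hL := hL) (b₀ := b₀) (b₁ := b₁) (Mstar := Mstar))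
        (fun _ => 1) H δ₀ α ML :=
  exists_lemma21Above_of_rowSum261 one_pos levelGap_geo9Y_one rowSum261_geo9Y (L := ((ℓ + 1 : ℕ) : ℝ))
    (fun x => (distOK_geo9Y x).one_le_L) (fun x => (geo9Y_L x).le) H hα0 hα1 hδ₀

variable {𝔸 : Type} [NormedRing 𝔸] [NormedAlgebra ℂ 𝔸] [CompleteSpace 𝔸] {G : Subgroup 𝔸ˣ}

/-- ★★ **THE (3.42) ⇒ (3.47) PASSAGE AT U = 1 ON THE CARRIERS OF RECORD WITH NO LEMMA-2.1 BINDER**: for every kernel family `K` over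
def-Y's members, every sub-family `P` of arguments with glob-readings, the (3.42) leaf `AtOneEOn geo9Y (bg9Y 𝔸 G) K P` gives the (3.47) leaf
`AtOneGlobOn geo9Y (bg9Y 𝔸 G) K P` — Lemma 2.1, η > 0, L = ℓ + 1 ≥ 1 and the sign facts all BY NAME from the record (n06-i
`B9GeoLemma21KLevelV1`, `B9GeoNormsKLevelModelSignsV1.modelSignsOn_geo9K`). [cite: Balaban1985BackgroundPropagators, Cor. 3.5 p.407 + (3.42) p.397 + (3.47) p.398; Balaban1984PropagatorsII, Lemma 2.1 pp.233–234] -/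
theorem atOneGlobOn_of_atOneEOn_geo9Y {K : ∀ x : MemberY d ℓ hd hL b₀ b₁ Mstar, B9.KernelFamily (geo9Y x) (bg9Y 𝔸 G x)}
    {P : ∀ x : MemberY d ℓ hd hL b₀ b₁ Mstar, (geo9Y x).Loc → Prop}
    {res : ∀ x : MemberY d ℓ hd hL b₀ b₁ Mstar, (geo9Y x).Site → (geo9Y x).Loc → (geo9Y x).Loc}
    (hR : ∀ x, GlobReading (K x) (P x) (bg9Y 𝔸 G x).one (res x)) (hE : AtOneEOn geo9Y (bg9Y 𝔸 G) K P) :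
    AtOneGlobOn geo9Y (bg9Y 𝔸 G) K P :=
  atOneGlobOn_of_atOneEOn_of_rowSum261 (fun x => modelSignsOn_geo9K x.toKIdx) hR (L := ((ℓ + 1 : ℕ) : ℝ))
    (by exact_mod_cast Nat.succ_le_succ (Nat.zero_le ℓ)) (fun x => (distOK_geo9Y x).one_le_L) (fun x => (geo9Y_L x).le)
    (fun x => (distOK_geo9Y x).eta_pos) one_pos levelGap_geo9Y_one rowSum261_geo9Y hE

end Lemma21StageY

/-! ## §3 Rows 15–16: Theorem 3.9 ∧ the kernel summation AT THE DEFINITE CONSTANT, fed by `RowSum261` -/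

section Rows1516

variable {I : Type} {c35 : ℝ} {geo : I → B9.Geometry} {bg : I → B9.Backgrounds}
variable [∀ i, Fintype (geo i).Site] [∀ i, DecidableEq (geo i).Site]
variable {ι κ : I → Type} [∀ i, Fintype (ι i)]

/-- ★ **THEOREM 3.9 AS THE WHOLE PRINTED LEAF AT THE DEFINITE DATUM** `EK39OfOps (𝔬 i) (rd i) d (2NB₀·rowConst261 geo (α′r)) ((1 − α′)r)`,
[4] Lemma 2.1 (2.61) SUPPLIED BY `RowSum261 geo` at both rates (αδ₀ for the O(M^{−1∕2}) constant, α′r for the kernel constant) — p. 413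
(3.98)–(3.99), *"For M sufficiently large"* absorbing the (2.59)-thresholds.  Inputs: 0 < α < 1, 0 < α′ ≦ 1, 0 < r ≦ δ₀, θ₀ ≧ 0, B₀ > 0,
N ≧ 0, a₁, M₁ > 0, `StaticOK39`, `Locality39`, `RowSum261 geo`, and per U under the provisos `Local348 ∧ Identities395 ∧ Small285 ∧
Factors389` — VERBATIM as `B9Thm39WholeGeneric.thm39Printed_of_rowSum261`, minus the transport binders `R`, `H` (internal: R = 0, H = True)
and with the constant NAMED instead of existential. [cite: Balaban1985BackgroundPropagators, Thm 3.9 (3.98)–(3.99) p.413 + (3.35) p.396; Balaban1984PropagatorsII, Lemma 2.1 (2.61) p.234] -/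
theorem thm39Printed_rowConst261_of_rowSum261 (𝔬 : ∀ i, Ops39 (geo i) (bg i) (ι i) (κ i))
    (rd : ∀ i, WalkReading39 (bg i) (ι i) (κ i)) (d : ℕ) (α α' r δ₀ θ₀ B₀ N a₁ M₁ : ℝ)
    (h35 : 0 < c35) (hα : 0 < α) (hα1 : α < 1) (hα'0 : 0 < α') (hα' : α' ≤ 1) (hr : 0 < r) (hrδ : r ≤ δ₀)
    (hθ₀ : 0 ≤ θ₀) (hB₀ : 0 < B₀) (hN : 0 ≤ N) (ha₁ : 0 < a₁) (hM₁ : 0 < M₁)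
    (hst : ∀ i, StaticOK39 (𝔬 i) N) (hloc : ∀ i, Locality39 (𝔬 i) (rd i)) (hrow : RowSum261 geo)
    (h39 : ∀ i, M₁ ≤ (geo i).M → ∀ α₀ : ℝ, 0 < α₀ → c35 * (geo i).M * α₀ ≤ a₁ →
      ∀ U : (bg i).Cfg, (bg i).Reg335 c35 α₀ U →
        Local348 (𝔬 i) d B₀ δ₀ U ∧ Identities395 (𝔬 i) U ∧ Small285 (𝔬 i) d θ₀ r U ∧ Factors389 (𝔬 i) d θ₀ δ₀ U) :
    B9.Thm39Printed d c35 geo bg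
      (fun i => EK39OfOps (𝔬 i) (rd i) d (2 * (N * B₀) * rowConst261 geo (α' * r)) ((1 - α') * r)) := by
  have hδ₀ : 0 < δ₀ := lt_of_lt_of_le hr hrδ
  obtain ⟨ML, h261⟩ := ineq261With_pair_rowConst261_of_rowSum261 (geo := geo) (fun _ => (0 : ℝ)) (fun _ => True)
    (mul_pos hα hδ₀) (mul_pos hα'0 hr) hrow
  exact thm39Printed_of_local348With 𝔬 rd (fun _ => (0 : ℝ)) (fun _ => True) (rowConst261 geo (α * δ₀))
    (rowConst261 geo (α' * r)) d α α' r δ₀ θ₀ B₀ N a₁ M₁ ML (rowConst261_nonneg geo _) (rowConst261_nonneg geo _) h35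
    hα.le hα1 hα' hr.le hrδ hδ₀ hθ₀ hB₀ hN ha₁ hM₁ hst hloc h261 h39

/-- ★★ **ROWS 15 AND 16 AT THE DEFINITE DATUM FROM `RowSum261`**: Theorem 3.9 as the whole printed leaf AND the kernel-summation leaf
`B9.RWKernelSumYields` (*"This theorem implies Theorem 3.2"*) at the SAME datum `EK39OfOps … (2NB₀·rowConst261 geo (α′r)) ((1 − α′)r)`, for
every carrier kernel `Cinv` READING the inverse of Q′G′²Q′\* (`KerReads`; the summation side by `B9Thm39Whole.rwKernelSumYields_EK39OfOps_of_len`,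
0 < (1 − α′)r from α′ < 1).  NO existential, NO (2.61) hypothesis: the knit may pin `(ops x).EK39` LITERALLY to this datum.
[cite: Balaban1985BackgroundPropagators, Thm 3.9 p.413 («This theorem implies Theorem 3.2») + Thm 3.2 (3.48) p.398; Balaban1984PropagatorsII, Lemma 2.1 (2.61) p.234] -/
theorem thm39_and_kernelSum_rowConst261_of_rowSum261 (𝔬 : ∀ i, Ops39 (geo i) (bg i) (ι i) (κ i))
    (rd : ∀ i, WalkReading39 (bg i) (ι i) (κ i)) (Cinv : ∀ i, B9.SiteKernel (geo i) (bg i)) (d : ℕ)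
    (α α' r δ₀ θ₀ B₀ N a₁ M₁ : ℝ)
    (h35 : 0 < c35) (hα : 0 < α) (hα1 : α < 1) (hα'0 : 0 < α') (hα'1 : α' < 1) (hr : 0 < r) (hrδ : r ≤ δ₀)
    (hθ₀ : 0 ≤ θ₀) (hB₀ : 0 < B₀) (hN : 0 ≤ N) (ha₁ : 0 < a₁) (hM₁ : 0 < M₁)
    (hst : ∀ i, StaticOK39 (𝔬 i) N) (hloc : ∀ i, Locality39 (𝔬 i) (rd i)) (hrow : RowSum261 geo)
    (hrd : ∀ i, KerReads (𝔬 i) (Cinv i) d)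
    (h39 : ∀ i, M₁ ≤ (geo i).M → ∀ α₀ : ℝ, 0 < α₀ → c35 * (geo i).M * α₀ ≤ a₁ →
      ∀ U : (bg i).Cfg, (bg i).Reg335 c35 α₀ U →
        Local348 (𝔬 i) d B₀ δ₀ U ∧ Identities395 (𝔬 i) U ∧ Small285 (𝔬 i) d θ₀ r U ∧ Factors389 (𝔬 i) d θ₀ δ₀ U) :
    B9.Thm39Printed d c35 geo bg
        (fun i => EK39OfOps (𝔬 i) (rd i) d (2 * (N * B₀) * rowConst261 geo (α' * r)) ((1 - α') * r)) ∧
      B9.RWKernelSumYields d geo bg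
        (fun i => EK39OfOps (𝔬 i) (rd i) d (2 * (N * B₀) * rowConst261 geo (α' * r)) ((1 - α') * r)) Cinv := by
  have hδ₁ : 0 < (1 - α') * r := mul_pos (by linarith) hr
  exact ⟨thm39Printed_rowConst261_of_rowSum261 𝔬 rd d α α' r δ₀ θ₀ B₀ N a₁ M₁ h35 hα hα1 hα'0 hα'1.le hr hrδ hθ₀ hB₀
      hN ha₁ hM₁ hst hloc hrow h39,
    rwKernelSumYields_EK39OfOps_of_len 𝔬 rd Cinv d hδ₁ (fun i y => (hst i).lenpos y) hrd⟩

/-- **PIN FORM**: for expansion data `EK i` EQUAL to the definite datum (the knit's literal pin, member by member), rows 15 ∧ 16 about `EK`.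
[cite: Balaban1985BackgroundPropagators, Thm 3.9 (3.98)–(3.99) p.413 + Thm 3.2 (3.48) p.398] -/
theorem thm39_and_kernelSum_of_pin_rowConst261 (𝔬 : ∀ i, Ops39 (geo i) (bg i) (ι i) (κ i))
    (rd : ∀ i, WalkReading39 (bg i) (ι i) (κ i)) (Cinv : ∀ i, B9.SiteKernel (geo i) (bg i)) (d : ℕ)
    (α α' r δ₀ θ₀ B₀ N a₁ M₁ : ℝ)
    (h35 : 0 < c35) (hα : 0 < α) (hα1 : α < 1) (hα'0 : 0 < α') (hα'1 : α' < 1) (hr : 0 < r) (hrδ : r ≤ δ₀)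
    (hθ₀ : 0 ≤ θ₀) (hB₀ : 0 < B₀) (hN : 0 ≤ N) (ha₁ : 0 < a₁) (hM₁ : 0 < M₁)
    (hst : ∀ i, StaticOK39 (𝔬 i) N) (hloc : ∀ i, Locality39 (𝔬 i) (rd i)) (hrow : RowSum261 geo)
    (hrd : ∀ i, KerReads (𝔬 i) (Cinv i) d)
    (h39 : ∀ i, M₁ ≤ (geo i).M → ∀ α₀ : ℝ, 0 < α₀ → c35 * (geo i).M * α₀ ≤ a₁ →
      ∀ U : (bg i).Cfg, (bg i).Reg335 c35 α₀ U →
        Local348 (𝔬 i) d B₀ δ₀ U ∧ Identities395 (𝔬 i) U ∧ Small285 (𝔬 i) d θ₀ r U ∧ Factors389 (𝔬 i) d θ₀ δ₀ U)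
    {EK : ∀ i, B9.RWKernelExpansion (geo i) (bg i)}
    (hEK : ∀ i, EK i = EK39OfOps (𝔬 i) (rd i) d (2 * (N * B₀) * rowConst261 geo (α' * r)) ((1 - α') * r)) :
    B9.Thm39Printed d c35 geo bg EK ∧ B9.RWKernelSumYields d geo bg EK Cinv := by
  obtain rfl : EK = fun i => EK39OfOps (𝔬 i) (rd i) d (2 * (N * B₀) * rowConst261 geo (α' * r)) ((1 - α') * r) :=
    funext hEK
  exact thm39_and_kernelSum_rowConst261_of_rowSum261 𝔬 rd Cinv d α α' r δ₀ θ₀ B₀ N a₁ M₁ h35 hα hα1 hα'0 hα'1 hr hrδ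
    hθ₀ hB₀ hN ha₁ hM₁ hst hloc hrow hrd h39

/-- **THEOREM 3.2 AS TYPED at the pinned definite datum** (p. 413: *"This theorem implies Theorem 3.2"*, the cell's `B9.thm32_of_thm39`).
[cite: Balaban1985BackgroundPropagators, Thm 3.9 ⇒ Thm 3.2 p.413 + Thm 3.2 (3.48) p.398] -/
theorem thm32Printed_of_pin_rowConst261 (𝔬 : ∀ i, Ops39 (geo i) (bg i) (ι i) (κ i))
    (rd : ∀ i, WalkReading39 (bg i) (ι i) (κ i)) (Cinv : ∀ i, B9.SiteKernel (geo i) (bg i)) (d : ℕ)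
    (α α' r δ₀ θ₀ B₀ N a₁ M₁ : ℝ)
    (h35 : 0 < c35) (hα : 0 < α) (hα1 : α < 1) (hα'0 : 0 < α') (hα'1 : α' < 1) (hr : 0 < r) (hrδ : r ≤ δ₀)
    (hθ₀ : 0 ≤ θ₀) (hB₀ : 0 < B₀) (hN : 0 ≤ N) (ha₁ : 0 < a₁) (hM₁ : 0 < M₁)
    (hst : ∀ i, StaticOK39 (𝔬 i) N) (hloc : ∀ i, Locality39 (𝔬 i) (rd i)) (hrow : RowSum261 geo)
    (hrd : ∀ i, KerReads (𝔬 i) (Cinv i) d)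
    (h39 : ∀ i, M₁ ≤ (geo i).M → ∀ α₀ : ℝ, 0 < α₀ → c35 * (geo i).M * α₀ ≤ a₁ →
      ∀ U : (bg i).Cfg, (bg i).Reg335 c35 α₀ U →
        Local348 (𝔬 i) d B₀ δ₀ U ∧ Identities395 (𝔬 i) U ∧ Small285 (𝔬 i) d θ₀ r U ∧ Factors389 (𝔬 i) d θ₀ δ₀ U)
    {EK : ∀ i, B9.RWKernelExpansion (geo i) (bg i)}
    (hEK : ∀ i, EK i = EK39OfOps (𝔬 i) (rd i) d (2 * (N * B₀) * rowConst261 geo (α' * r)) ((1 - α') * r)) :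
    B9.Thm32Printed d c35 geo bg Cinv := by
  obtain ⟨h39P, hks⟩ := thm39_and_kernelSum_of_pin_rowConst261 𝔬 rd Cinv d α α' r δ₀ θ₀ B₀ N a₁ M₁ h35 hα hα1 hα'0
    hα'1 hr hrδ hθ₀ hB₀ hN ha₁ hM₁ hst hloc hrow hrd h39 hEK
  exact B9.thm32_of_thm39 d c35 geo bg _ Cinv h39P hks

end Rows1516

/-! ## §4 At def-Y's operator-layer signature over the members of record: rows 15 ∧ 16 from the LITERAL pin, ZERO Lemma-2.1 binders -/

section StageY

variable {d ℓ : ℕ} {hd : 1 ≤ d + 1} {hL : Odd (ℓ + 1) ∧ 1 < ℓ + 1} {b₀ b₁ : ℝ} {Mstar : ℕ}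
variable {𝔸 : Type} [NormedRing 𝔸] [NormedAlgebra ℂ 𝔸] [CompleteSpace 𝔸] {G : Subgroup 𝔸ˣ}
variable (ops : ∀ x : MemberY d ℓ hd hL b₀ b₁ Mstar, OperatorLayerY d ℓ hd hL b₀ b₁ Mstar 𝔸 G x)
variable [∀ x : MemberY d ℓ hd hL b₀ b₁ Mstar, Fintype (geo9Y x).Site]
  [∀ x : MemberY d ℓ hd hL b₀ b₁ Mstar, DecidableEq (geo9Y x).Site]
variable {c35 : ℝ} {ι κ : MemberY d ℓ hd hL b₀ b₁ Mstar → Type} [∀ x, Fintype (ι x)]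

/-- ★★ **ROWS 15 ∧ 16 OF THE N06 KNIT FROM THE LITERAL PIN AT THE DEFINITE CONSTANT, NO (2.61) BINDER** (the drop-in for n06-d's
`…ObligationsPins2.t39_of_pin` + `hksum_of_pin`): over def-Y's operator layer `ops`, for Theorem-3.9 letters `𝔬39` read by `rd39`, the pin
`(ops x).EK39 = EK39OfOps (𝔬39 x) (rd39 x) dd (2(N·B₀)·rowConst261 geo9Y (α′r)) ((1−α′)r)` and a carrier kernel `(ops x).Cinv` READING the
inverse give `B9.Thm39Printed dd c35 geo9Y (bg9Y 𝔸 G) (fun x => (ops x).EK39)` ∧ `B9.RWKernelSumYields dd geo9Y (bg9Y 𝔸 G) (fun x =>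
(ops x).EK39) (fun x => (ops x).Cinv)` — the certificate's two binders verbatim; [4] (2.61) at both rates is n06-i's `rowSum261_geo9Y` BY
NAME.  Remaining displayed inputs: the schemas `StaticOK39`, `Locality39`, the per-U provisos block, `KerReads`, and the numeric ranges
(0 < α < 1, 0 < α′ < 1, 0 < r ≦ δ₀, …). [cite: Balaban1985BackgroundPropagators, Thm 3.9 (3.98)–(3.99) p.413 + Thm 3.2 (3.48) p.398; Balaban1984PropagatorsII, Lemma 2.1 (2.61) p.234] -/
theorem t39_hksum_of_pin_rowConst261
    (𝔬39 : ∀ x : MemberY d ℓ hd hL b₀ b₁ Mstar, Ops39 (geo9Y x) (bg9Y 𝔸 G x) (ι x) (κ x))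
    (rd39 : ∀ x : MemberY d ℓ hd hL b₀ b₁ Mstar, WalkReading39 (bg9Y 𝔸 G x) (ι x) (κ x))
    (dd : ℕ) (α α' r δ₀ θ₀ B₀ N a₁ M₁ : ℝ)
    (h35 : 0 < c35) (hα : 0 < α) (hα1 : α < 1) (hα'0 : 0 < α') (hα'1 : α' < 1) (hr : 0 < r) (hrδ : r ≤ δ₀)
    (hθ₀ : 0 ≤ θ₀) (hB₀ : 0 < B₀) (hN : 0 ≤ N) (ha₁ : 0 < a₁) (hM₁ : 0 < M₁)
    (hst : ∀ x, StaticOK39 (𝔬39 x) N) (hloc : ∀ x, Locality39 (𝔬39 x) (rd39 x))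
    (h39 : ∀ x : MemberY d ℓ hd hL b₀ b₁ Mstar, M₁ ≤ (geo9Y x).M → ∀ α₀ : ℝ, 0 < α₀ → c35 * (geo9Y x).M * α₀ ≤ a₁ →
      ∀ U : (bg9Y 𝔸 G x).Cfg, (bg9Y 𝔸 G x).Reg335 c35 α₀ U →
        Local348 (𝔬39 x) dd B₀ δ₀ U ∧ Identities395 (𝔬39 x) U ∧ Small285 (𝔬39 x) dd θ₀ r U ∧
          Factors389 (𝔬39 x) dd θ₀ δ₀ U)
    (hEK39 : ∀ x : MemberY d ℓ hd hL b₀ b₁ Mstar, (ops x).EK39 =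
      EK39OfOps (𝔬39 x) (rd39 x) dd
        (2 * (N * B₀) * rowConst261 (geo9Y (d := d) (ℓ := ℓ) (hd := hd) (hL := hL) (b₀ := b₀) (b₁ := b₁) (Mstar := Mstar))
          (α' * r)) ((1 - α') * r))
    (hrdC : ∀ x : MemberY d ℓ hd hL b₀ b₁ Mstar, KerReads (𝔬39 x) (ops x).Cinv dd) :
    B9.Thm39Printed dd c35 geo9Y (bg9Y 𝔸 G) (fun x => (ops x).EK39) ∧
      B9.RWKernelSumYields dd geo9Y (bg9Y 𝔸 G) (fun x => (ops x).EK39) (fun x => (ops x).Cinv) :=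
  thm39_and_kernelSum_of_pin_rowConst261 𝔬39 rd39 (fun x => (ops x).Cinv) dd α α' r δ₀ θ₀ B₀ N a₁ M₁ h35 hα hα1 hα'0
    hα'1 hr hrδ hθ₀ hB₀ hN ha₁ hM₁ hst hloc rowSum261_geo9Y hrdC h39 hEK39

/-- **THE RECORD COROLLARY WITH THE EXPLICIT DATUM** (for an END consumer that chooses the expansion letter `𝔈.EK39` itself): rows 15 ∧ 16 at
`EK39OfOps (𝔬39 x) (rd39 x) dd (2(N·B₀)·rowConst261 geo9Y (α′r)) ((1−α′)r)` on def-Y's members, (2.61) by `rowSum261_geo9Y`.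
[cite: Balaban1985BackgroundPropagators, Thm 3.9 (3.98)–(3.99) p.413 + Thm 3.2 (3.48) p.398; Balaban1984PropagatorsII, Lemma 2.1 (2.61) p.234] -/
theorem thm39_and_kernelSum_geo9Y
    (𝔬39 : ∀ x : MemberY d ℓ hd hL b₀ b₁ Mstar, Ops39 (geo9Y x) (bg9Y 𝔸 G x) (ι x) (κ x))
    (rd39 : ∀ x : MemberY d ℓ hd hL b₀ b₁ Mstar, WalkReading39 (bg9Y 𝔸 G x) (ι x) (κ x))
    (Cinv : ∀ x : MemberY d ℓ hd hL b₀ b₁ Mstar, B9.SiteKernel (geo9Y x) (bg9Y 𝔸 G x))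
    (dd : ℕ) (α α' r δ₀ θ₀ B₀ N a₁ M₁ : ℝ)
    (h35 : 0 < c35) (hα : 0 < α) (hα1 : α < 1) (hα'0 : 0 < α') (hα'1 : α' < 1) (hr : 0 < r) (hrδ : r ≤ δ₀)
    (hθ₀ : 0 ≤ θ₀) (hB₀ : 0 < B₀) (hN : 0 ≤ N) (ha₁ : 0 < a₁) (hM₁ : 0 < M₁)
    (hst : ∀ x, StaticOK39 (𝔬39 x) N) (hloc : ∀ x, Locality39 (𝔬39 x) (rd39 x))
    (hrd : ∀ x, KerReads (𝔬39 x) (Cinv x) dd)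
    (h39 : ∀ x : MemberY d ℓ hd hL b₀ b₁ Mstar, M₁ ≤ (geo9Y x).M → ∀ α₀ : ℝ, 0 < α₀ → c35 * (geo9Y x).M * α₀ ≤ a₁ →
      ∀ U : (bg9Y 𝔸 G x).Cfg, (bg9Y 𝔸 G x).Reg335 c35 α₀ U →
        Local348 (𝔬39 x) dd B₀ δ₀ U ∧ Identities395 (𝔬39 x) U ∧ Small285 (𝔬39 x) dd θ₀ r U ∧
          Factors389 (𝔬39 x) dd θ₀ δ₀ U) :
    B9.Thm39Printed dd c35 geo9Y (bg9Y 𝔸 G)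
        (fun x => EK39OfOps (𝔬39 x) (rd39 x) dd
          (2 * (N * B₀) * rowConst261 (geo9Y (d := d) (ℓ := ℓ) (hd := hd) (hL := hL) (b₀ := b₀) (b₁ := b₁) (Mstar := Mstar))
            (α' * r)) ((1 - α') * r)) ∧
      B9.RWKernelSumYields dd geo9Y (bg9Y 𝔸 G)
        (fun x => EK39OfOps (𝔬39 x) (rd39 x) dd
          (2 * (N * B₀) * rowConst261 (geo9Y (d := d) (ℓ := ℓ) (hd := hd) (hL := hL) (b₀ := b₀) (b₁ := b₁) (Mstar := Mstar))
            (α' * r)) ((1 - α') * r)) Cinv :=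
  thm39_and_kernelSum_rowConst261_of_rowSum261 𝔬39 rd39 Cinv dd α α' r δ₀ θ₀ B₀ N a₁ M₁ h35 hα hα1 hα'0 hα'1 hr hrδ
    hθ₀ hB₀ hN ha₁ hM₁ hst hloc rowSum261_geo9Y hrd h39

end StageY

end Literature.MathematicalPhysics.QuantumFieldTheory.Balaban1983to89.B9RowSum261DefiniteFaces

end
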